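import Summits.Schanuel.Schanuel.Theorems.ZilberEacEquimodularAccumulation
import Summits.Schanuel.Schanuel.Theorems.ZilberEacEquimodularPhases
import Summits.Schanuel.Schanuel.Theorems.ZilberEacLogStrip
import Summits.Schanuel.Schanuel.Theorems.ZilberEacGraphCurveEscapeLocal
import Summits.Schanuel.Schanuel.Theorems.ZilberEacFibreCurveZeros
import Mathlib.Analysis.Polynomial.Basic
import HarnessLib

/-!
# The equimodular class, XV: tools for `y₀`-linear fibres over polynomial graphs — the phase
# polynomial's real and imaginary parts, the growth ratio, exponential points with all large labels

HONEST FRAMING.  Cell `pub-schanuel` (Zilber's Exponential-Algebraic Closedness, case ladder;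
host summit Schanuel), seat 2, gen 23.  Elementary tools for file XVI:
* `exists_re_im_polynomials`: for `Q ∈ ℂ[X]`, real polynomials `g_R, g_I` with
  `exp(Q(x)) = e^{g_R(x)} · urot(g_I(x))` and `Re Q(x) = g_R(x)` for real `x`;
* `log_two_add_norm_eval_le_log_label`: `log(2 + ‖p(z)‖) ≤ D·log(3 + 3k)` when `‖z‖ ≤ α + 7k`;
* `eventually_mul_le_abs_eval`: a real polynomial of positive degree dominates `c·x`;
* `tendsto_abs_div_log_of_linear_growth`: the growth ratio `|a_m| / L_m → ∞` from a polynomial main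
  term and a logarithmic denominator (the input of THEOREM G, `unprojectedDense_of_growth`);
* `exists_labelled_expPoints`: solutions of `A(z)e^z + B(z) = 0` with EVERY large label `k`
  (`‖z_k - τ' - 2πik‖ < 1`), beyond any radius (gen 22's `exists_expPoint_near_label`, packaged).
[folklore]; nothing here is specific to Schanuel's conjecture; Mantova–Masser's question and EC(3,2)
stay OPEN.
-/

noncomputable section

open Filter Topology Polynomial Complex Asymptotics

set_option linter.dupNamespace false

namespace Summit.Schanuel.Schanuel.Theorems

/-! ## Part A. Real and imaginary parts of a complex polynomial on the real line -/

/-- **Real/imaginary split of a complex polynomial on `ℝ`**: `g_R = Σ Re(Q_j) X^j`,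
`g_I = Σ (Im(Q_j)/2π) X^j` satisfy `Re Q(x) = g_R(x)` and `exp(Q(x)) = e^{g_R(x)}·urot(g_I(x))` for
real `x`. [folklore] -/
theorem exists_re_im_polynomials (Q : ℂ[X]) : ∃ gR gI : ℝ[X],
    (∀ x : ℝ, (Q.eval (x : ℂ)).re = gR.eval x) ∧
    ∀ x : ℝ, Complex.exp (Q.eval (x : ℂ)) = (Real.exp (gR.eval x) : ℂ) * urot (gI.eval x) := by
  classical
  set n := Q.natDegree + 1 with hn
  set gR : ℝ[X] := ∑ j ∈ Finset.range n, Polynomial.monomial j (Q.coeff j).re with hgR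
  set gI : ℝ[X] := ∑ j ∈ Finset.range n, Polynomial.monomial j ((Q.coeff j).im / (2 * Real.pi))
    with hgI
  have hre : ∀ x : ℝ, (Q.eval (x : ℂ)).re = gR.eval x := by
    intro x
    rw [Polynomial.eval_eq_sum_range, Complex.re_sum, hgR, Polynomial.eval_finsetSum]
    refine Finset.sum_congr rfl fun j _ => ?_
    rw [Polynomial.eval_monomial, ← Complex.ofReal_pow, Complex.re_mul_ofReal]
  have him : ∀ x : ℝ, (Q.eval (x : ℂ)).im = 2 * Real.pi * gI.eval x := by
    intro x
    rw [Polynomial.eval_eq_sum_range, Complex.im_sum, hgI, Polynomial.eval_finsetSum, Finset.mul_sum]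
    refine Finset.sum_congr rfl fun j _ => ?_
    rw [Polynomial.eval_monomial, ← Complex.ofReal_pow, Complex.im_mul_ofReal]
    field_simp
  refine ⟨gR, gI, hre, fun x => ?_⟩
  conv_lhs => rw [← Complex.re_add_im (Q.eval (x : ℂ)), hre x, him x]
  rw [Complex.exp_add, Complex.ofReal_exp, urot]
  congr 1
  push_cast
  ring_nf

/-! ## Part B. The growth ratio -/

/-- **Logarithmic upper bound for a polynomial along an affinely bounded sequence**: if
`‖z‖ ≤ α + 7k` (`α ≥ 0`, `k ≥ 0`) then `log(2 + ‖p(z)‖) ≤ D·log(3 + 3k)` for a constant `D > 0`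
depending on `p, α`. [folklore] -/
theorem log_two_add_norm_eval_le_log_label (p : ℂ[X]) {α : ℝ} (hα : 0 ≤ α) :
    ∃ D : ℝ, 0 < D ∧ ∀ (z : ℂ) (k : ℝ), 0 ≤ k → ‖z‖ ≤ α + 7 * k →
      Real.log (2 + ‖p.eval z‖) ≤ D * Real.log (3 + 3 * k) := by
  set S : ℝ := ∑ j ∈ Finset.range (p.natDegree + 1), ‖p.coeff j‖ with hS
  have hS0 : 0 ≤ S := Finset.sum_nonneg fun j _ => norm_nonneg _
  set d := p.natDegree with hd
  set β : ℝ := 1 + α + 7 with hβ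
  have hβ1 : 1 ≤ β := by rw [hβ]; linarith
  set c₁ : ℝ := Real.log (2 + S * β ^ d) with hc₁
  have hSβ : 0 ≤ S * β ^ d := by positivity
  have hc₁0 : 0 ≤ c₁ := Real.log_nonneg (by linarith)
  refine ⟨c₁ + d + 1, by positivity, fun z k hk hz => ?_⟩
  have hlog3 : 1 ≤ Real.log (3 + 3 * k) := one_le_log_three_add k hk
  have h1 : 1 + ‖z‖ ≤ β * (1 + k) := by rw [hβ]; nlinarith
  have h2 : ‖p.eval z‖ ≤ S * (β * (1 + k)) ^ d :=
    (norm_eval_le_pow p z).trans (mul_le_mul_of_nonneg_left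
      (pow_le_pow_left₀ (by positivity) h1 d) hS0)
  have h1k : 1 ≤ (1 + k) ^ d := one_le_pow₀ (by linarith)
  have h3 : 2 + ‖p.eval z‖ ≤ (2 + S * β ^ d) * (1 + k) ^ d := by
    rw [mul_pow] at h2; nlinarith
  have h4 : Real.log (2 + ‖p.eval z‖) ≤ c₁ + d * Real.log (1 + k) := by
    calc Real.log (2 + ‖p.eval z‖) ≤ Real.log ((2 + S * β ^ d) * (1 + k) ^ d) :=
          Real.log_le_log (by positivity) h3
      _ = c₁ + d * Real.log (1 + k) := by
          rw [Real.log_mul (by positivity) (by positivity), Real.log_pow, hc₁]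
  have h5 : Real.log (1 + k) ≤ Real.log (3 + 3 * k) :=
    Real.log_le_log (by linarith) (by linarith)
  have h6 : (d : ℝ) * Real.log (1 + k) ≤ d * Real.log (3 + 3 * k) :=
    mul_le_mul_of_nonneg_left h5 (Nat.cast_nonneg d)
  nlinarith

/-- **A real polynomial of positive degree dominates a linear function**: there is `c > 0` with
`c·x ≤ |g(x)|` for all large real `x`. [folklore] -/
theorem eventually_mul_le_abs_eval (g : ℝ[X]) (hg : 1 ≤ g.natDegree) :
    ∃ c : ℝ, 0 < c ∧ ∀ᶠ x : ℝ in atTop, c * x ≤ |g.eval x| := by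
  have hg0 : g ≠ 0 := by
    intro h; rw [h, Polynomial.natDegree_zero] at hg; omega
  have hlc : 0 < |g.leadingCoeff| := abs_pos.2 (Polynomial.leadingCoeff_ne_zero.2 hg0)
  refine ⟨|g.leadingCoeff| / 2, by positivity, ?_⟩
  have h := (Polynomial.isEquivalent_atTop_lead (P := g)).isLittleO.def (by norm_num : (0 : ℝ) < 1 / 2)
  filter_upwards [h, eventually_ge_atTop (1 : ℝ)] with x hx hx1
  simp only [Pi.sub_apply, Real.norm_eq_abs] at hx
  have hxd : x ≤ x ^ g.natDegree := by
    calc x = x ^ 1 := (pow_one x).symm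
      _ ≤ x ^ g.natDegree := pow_le_pow_right₀ hx1 hg
  have hv : |g.leadingCoeff * x ^ g.natDegree| = |g.leadingCoeff| * x ^ g.natDegree := by
    rw [abs_mul, abs_of_nonneg (show (0 : ℝ) ≤ x ^ g.natDegree by positivity)]
  rw [hv] at hx
  have htri : |g.leadingCoeff| * x ^ g.natDegree - |eval x g - g.leadingCoeff * x ^ g.natDegree| ≤
      |eval x g| := by
    have := abs_sub_abs_le_abs_sub (g.leadingCoeff * x ^ g.natDegree) (eval x g)
    rw [abs_sub_comm] at this
    rw [hv.symm]
    linarith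
  nlinarith

/-- **The growth ratio.**  `a_m` within `M` of `g(k₀ + m)` for a real polynomial `g` of positive
degree, and `log 2 ≤ L_m ≤ D·log(3 + 3(k₀ + m))`: then `|a_m| / L_m → ∞`. [folklore] -/
theorem tendsto_abs_div_log_of_linear_growth {g : ℝ[X]} (hg : 1 ≤ g.natDegree) {a L : ℕ → ℝ}
    (k₀ : ℕ) {M D : ℝ} (hD : 0 < D) (ha : ∀ m, |a m - g.eval ((k₀ + m : ℕ) : ℝ)| ≤ M)
    (hL2 : ∀ m, Real.log 2 ≤ L m) (hLD : ∀ m, L m ≤ D * Real.log (3 + 3 * ((k₀ + m : ℕ) : ℝ))) :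
    Tendsto (fun m => |a m| / L m) atTop atTop := by
  obtain ⟨c, hc, hev⟩ := eventually_mul_le_abs_eval g hg
  have hlog2 : 0 < Real.log 2 := Real.log_pos one_lt_two
  have hM0 : 0 ≤ M := (abs_nonneg _).trans (ha 0)
  -- the label sequence tends to infinity
  have hkm : Tendsto (fun m : ℕ => ((k₀ + m : ℕ) : ℝ)) atTop atTop :=
    tendsto_natCast_atTop_atTop.comp (tendsto_add_atTop_nat k₀ |>.congr fun m => by ring_nf)
  -- comparison sequence
  have hcmp : Tendsto (fun m : ℕ => c / D * (((k₀ + m : ℕ) : ℝ) / Real.log (3 + 3 * ((k₀ + m : ℕ) : ℝ)))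
      + -(M / Real.log 2)) atTop atTop := by
    refine tendsto_atTop_add_const_right _ _ ?_
    exact ((gce_tendsto_div_log_affine (by norm_num : (1 : ℝ) < 3) (by norm_num : (0 : ℝ) < 3)).comp
      hkm).const_mul_atTop (by positivity)
  refine tendsto_atTop_mono' _ ?_ hcmp
  filter_upwards [hkm.eventually hev, hkm.eventually (eventually_ge_atTop (0 : ℝ))] with m hm hm0
  set x : ℝ := ((k₀ + m : ℕ) : ℝ) with hx
  have hLpos : 0 < L m := hlog2.trans_le (hL2 m)
  have hlog3 : 1 ≤ Real.log (3 + 3 * x) := one_le_log_three_add x hm0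
  have h1 : c * x - M ≤ |a m| := by
    have := abs_sub_abs_le_abs_sub (g.eval x) (a m)
    rw [abs_sub_comm] at this
    linarith [ha m]
  have h2 : c / D * (x / Real.log (3 + 3 * x)) ≤ c * x / L m := by
    rw [div_mul_div_comm, div_le_div_iff₀ (by positivity) hLpos]
    have := hLD m
    have hcx : 0 ≤ c * x := by positivity
    nlinarith
  have h3 : -(M / Real.log 2) ≤ -(M / L m) := by
    rw [neg_le_neg_iff]
    exact div_le_div_of_nonneg_left hM0 hlog2 (hL2 m)
  have h4 : c * x / L m - M / L m ≤ |a m| / L m := by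
    rw [← sub_div]
    exact div_le_div_of_nonneg_right h1 hLpos.le
  linarith

/-! ## Part C. Exponential points with all large labels, beyond a radius -/

/-- **Labelled exponential points.**  `deg A = deg B ≥ 1`, `lc B = -e^{τ'} lc A`: for every radius
`R` there are `k₀` and solutions `z_m` of `A(z)e^z + B(z) = 0` (`m ∈ ℕ`) with label `k₀ + m`
(`‖z_m - τ' - 2πi(k₀ + m)‖ < 1`), `‖z_m‖ > R`, `‖z_m‖ → ∞`, and `‖z_m‖ ≤ ‖τ'‖ + 1 + 7(k₀ + m)`.
(new) -/
theorem exists_labelled_expPoints (A B : ℂ[X]) (hN : 1 ≤ A.natDegree)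
    (hdeg : B.natDegree = A.natDegree) (τ' : ℂ)
    (hlc : B.leadingCoeff = -Complex.exp τ' * A.leadingCoeff) (R : ℝ) :
    ∃ (k₀ : ℕ) (z : ℕ → ℂ), (∀ m, ‖z m - τ' - ((k₀ + m : ℕ) : ℂ) * (2 * Real.pi * I)‖ < 1) ∧
      (∀ m, A.eval (z m) * Complex.exp (z m) + B.eval (z m) = 0) ∧ (∀ m, R < ‖z m‖) ∧
      Tendsto (fun m => ‖z m‖) atTop atTop ∧
      ∀ m, ‖z m‖ ≤ ‖τ'‖ + 1 + 7 * ((k₀ + m : ℕ) : ℝ) := by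
  obtain ⟨K, hK⟩ := exists_expPoint_near_label A B hN hdeg τ' hlc one_pos
  obtain ⟨K', hK'⟩ : ∃ K' : ℕ, ∀ k : ℕ, K' ≤ k → R + ‖τ'‖ + 1 < 2 * Real.pi * k := by
    obtain ⟨K', hK'⟩ := exists_nat_gt ((R + ‖τ'‖ + 1) / (2 * Real.pi))
    refine ⟨K', fun k hk => ?_⟩
    rw [div_lt_iff₀ Real.two_pi_pos] at hK'
    have : (K' : ℝ) ≤ k := by exact_mod_cast hk
    nlinarith [Real.pi_pos]
  set k₀ : ℕ := max K K' with hk₀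
  have hzex : ∀ m : ℕ, ∃ z : ℂ, ‖z - τ' - ((k₀ + m : ℕ) : ℂ) * (2 * Real.pi * I)‖ < 1 ∧
      A.eval z * Complex.exp z + B.eval z = 0 := fun m =>
    hK (k₀ + m) ((le_max_left K K').trans (Nat.le_add_right _ _))
  choose z hzlab hzeq using hzex
  have hnk : ∀ m, ‖((k₀ + m : ℕ) : ℂ) * (2 * Real.pi * I)‖ = 2 * Real.pi * ((k₀ + m : ℕ) : ℝ) := by
    intro m
    rw [norm_mul, Complex.norm_natCast]
    simp [abs_of_pos Real.pi_pos]
    ring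
  have hzlow : ∀ m, 2 * Real.pi * ((k₀ + m : ℕ) : ℝ) - ‖τ'‖ - 1 ≤ ‖z m‖ := by
    intro m
    have h2 := norm_sub_le_norm_sub_add_norm_sub (((k₀ + m : ℕ) : ℂ) * (2 * Real.pi * I))
      (z m - τ') 0
    rw [sub_zero, sub_zero, norm_sub_rev, hnk m] at h2
    have h3 : ‖z m - τ'‖ ≤ ‖z m‖ + ‖τ'‖ := norm_sub_le _ _
    linarith [hzlab m]
  have hzup : ∀ m, ‖z m‖ ≤ ‖τ'‖ + 1 + 7 * ((k₀ + m : ℕ) : ℝ) := by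
    intro m
    have h1 : ‖z m‖ ≤ ‖z m - τ' - ((k₀ + m : ℕ) : ℂ) * (2 * Real.pi * I)‖ + ‖τ'‖ +
        ‖((k₀ + m : ℕ) : ℂ) * (2 * Real.pi * I)‖ := by
      have e : z m = (z m - τ' - ((k₀ + m : ℕ) : ℂ) * (2 * Real.pi * I)) + τ' +
          ((k₀ + m : ℕ) : ℂ) * (2 * Real.pi * I) := by ring
      calc ‖z m‖ = ‖(z m - τ' - ((k₀ + m : ℕ) : ℂ) * (2 * Real.pi * I)) + τ' +
            ((k₀ + m : ℕ) : ℂ) * (2 * Real.pi * I)‖ := by rw [← e]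
        _ ≤ _ := norm_add₃_le
    rw [hnk m] at h1
    have hk0 : (0 : ℝ) ≤ ((k₀ + m : ℕ) : ℝ) := Nat.cast_nonneg _
    nlinarith [hzlab m, Real.pi_lt_d2, Real.pi_pos]
  refine ⟨k₀, z, hzlab, hzeq, fun m => ?_, ?_, hzup⟩
  · have := hK' (k₀ + m) ((le_max_right K K').trans (Nat.le_add_right _ _))
    linarith [hzlow m]
  · refine tendsto_atTop_mono hzlow ?_
    have h1 : Tendsto (fun m : ℕ => 2 * Real.pi * ((k₀ + m : ℕ) : ℝ)) atTop atTop := by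
      refine Tendsto.const_mul_atTop Real.two_pi_pos ?_
      exact tendsto_natCast_atTop_atTop.comp (tendsto_add_atTop_nat k₀ |>.congr fun m => by ring_nf)
    have h2 := tendsto_atTop_add_const_right atTop (-‖τ'‖ - 1) h1
    exact h2.congr fun m => by ring

end Summit.Schanuel.Schanuel.Theorems
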